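import Summits.QuantumFields.BalabanUV.Beta.CapRowsLattice

/-!
# Beta / CapRowsQhalf — BINDER-OWNERS row CAP-k, item (b): CONJUGATION SYMMETRY of the node sum and the paired («QHALF») ball
# (β sub-cell, DEDICATED row BETA-an5, lineage `b2b-balaban-beta-an5` = OWNER of row CAP-k; gen 20, prover seat; sibling of `CapRowsLattice`)

HONEST FRAMING (page 1 of everything the β sub-cell writes): discharging `BetaPertH` makes Bałaban's UV stability UNCONDITIONAL — a
real constructive-QFT result; it is NOT the continuum limit and NOT the Clay problem.  HONEST DEPENDENCY (cell reorg 2026-08-19, verbatim):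
«continuum YM on T⁴ ⇐ BetaPertH ∧ nine spine estimates (0/9 proved); BetaPertH ⇐ (D1) ∧ (D4) ∧ CAP+tail; G-an2-4 gates asym, D1 and NE2/3/4.»
THIS MODULE INSTANTIATES NO BINDER.  It answers, on the CONSUMER side, the referee's ruling R61-b (iv) (beta-cap-ref REPORT #61, journal
2026-08-20T02:05:40Z): «NO kernel binder (hT of `rowsOfCode16E`) is instantiated from a paired sum without a kernel-checked `t(−q) = conj t(q)`
lemma (numerical identity ≠ proof)».  The engines' conjugation pairing (cap5 `fibre5b` v0.9 «QHALF») sums the integrand over HALF the node set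
and uses `t(−q) = conj t(q)`.  Here that identity is a KERNEL consequence of ONE structural hypothesis on the typed integrand `G` —
`hsym : ∀ p : ℝ^{d+1}, G(−p) = conj (G p)` (reality of the position-space kernel; for a character sum `Σ_{ΔR} K[ΔR] e^{iq·ΔR}` with REAL
coefficient matrices and everything `PolyRegularAlgebra` builds from it, a structural fact to be discharged with the (Z) structure) — plus
strip regularity (for the face matching of `descend`):
 §1 negation on the grid and on the torus: `gridPt P (−w) = −gridPt P w`; `descend G (−t) = conj (descend G t)`; the node identity
    `descend G (gridPt P (−w)) = conj (descend G (gridPt P w))` — THE `t(−q) = conj t(q)` LEMMA; a sampling set closed under addition is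
    closed under negation (`neg_mem_of_add_closed`, finite-group bookkeeping; so `code16Set N`, `code16SetE N` qualify by name).
 §2 consequences for the node-set sum over any negation-closed `S`: it is self-conjugate, its imaginary part vanishes, it equals the sum of
    the REAL PARTS; the PAIRING IDENTITY `Σ_S Re g = Σ_{S₀} Re g + 2·Σ_R Re g` for any representative system (`S = S₀ ⊔ R ⊔ (−R)`, hypotheses
    on `S₀`, `R` as decidable Finset facts the certificate carries); and the BALL TRANSFER: a certified real ball
    `|(|S|⁻¹ Σ_S Re g) − t| ≤ r` IS the complex ball `hT` of `CapRowsLattice.rowsOfSampling ∕ rowsOfCode16(E)`.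
 §3 the anchor row from a real (paired) ball: `rowsOfCode16E_ofRealBall`.

ABSOLUTE RULE (cell charter, verbatim): "No internally-minted statement may enter as a cited fact. Every hypothesis is either
kernel-proved in this package or a verbatim quotation of a PUBLISHED theorem with page reference. The manuscript(s) under audit are
NOT citable for their own disputed steps — they are the thing under adjudication; programme-internal (2001/route/tribunal) claims
are never citable."  Nothing is cited here; every statement is finite-sum ∕ torus bookkeeping over the tree's own definitions. [folklore]
-/

namespace Summit.QuantumFields.BalabanUV.Beta.CapRowsQhalf

open Literature.MathematicalPhysics.QuantumFieldTheory.Balaban1983to89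
open Literature.MathematicalPhysics.QuantumFieldTheory.Balaban1983to89.Beta
open B4Strip (ofRealVec)
open B4ContourShift (latticeKernel StripRegular)
open B4TorusKernel (descend gridPt rep rep_mem rep_coe descend_coe unitBox)
open Beta.AliasingTailL1 (StripRegularC aliasRatioL1)
open Beta.AliasingTailLattice (codeTheta code16SetE zero_mem_code16SetE add_mem_code16SetE)
open Summit.QuantumFields.BalabanUV.Beta.CapRows (Rows)
open Summit.QuantumFields.BalabanUV.Beta.CapRowsLattice (rowsOfCode16E)
open scoped Real ComplexConjugate

noncomputable section

variable {d P : ℕ}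

/-! ## §1 Negation on the grid and on the torus; the `t(−q) = conj t(q)` lemma -/

/-- THE GRID IS SYMMETRIC: the grid point of `−w` is minus the grid point of `w` (in `(ℝ/ℤ)^{d+1}`). [folklore] -/
theorem gridPt_neg [NeZero P] (w : Fin (d + 1) → Fin P) : gridPt P (-w) = -gridPt P w := by
  funext i
  have hP : 0 < P := Nat.pos_of_ne_zero (NeZero.ne P)
  have hsum : (((-w) i : Fin P) : ℕ) + ((w i : Fin P) : ℕ) ≡ 0 [MOD P] := by
    have h0 : ((-w) i + w i : Fin P) = 0 := by simp
    have := congrArg Fin.val h0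
    rw [Fin.val_add] at this
    simpa [Nat.ModEq] using this
  obtain ⟨k, hk⟩ : P ∣ (((-w) i : Fin P) : ℕ) + ((w i : Fin P) : ℕ) := Nat.modEq_zero_iff_dvd.mp hsum
  show ((((((-w) i : Fin P) : ℕ) : ℝ) / P : ℝ) : UnitAddCircle) = -(((((w i : Fin P) : ℕ) : ℝ) / P : ℝ) : UnitAddCircle)
  rw [eq_neg_iff_add_eq_zero, ← AddCircle.coe_add, AddCircle.coe_eq_zero_iff]
  refine ⟨k, ?_⟩
  have hPr : (P : ℝ) ≠ 0 := by exact_mod_cast hP.ne'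
  have : ((((-w) i : Fin P) : ℕ) : ℝ) + (((w i : Fin P) : ℕ) : ℝ) = (P : ℝ) * k := by exact_mod_cast hk
  field_simp
  simp only [zsmul_eq_mul, Int.cast_natCast, mul_one]
  linarith

/-- **CONJUGATION SYMMETRY DESCENDS TO THE TORUS**: under strip regularity (face matching) and the structural symmetry
`G(−p) = conj G(p)` on real momenta, `descend G (−t) = conj (descend G t)` for every torus point `t`. [folklore] -/
theorem descend_neg {G : (Fin (d + 1) → ℂ) → ℂ} {κ M : ℝ} (h : StripRegular G κ M) (hκ : 0 ≤ κ)
    (hsym : ∀ p : Fin (d + 1) → ℝ, G (ofRealVec (-p)) = conj (G (ofRealVec p))) (t : UnitAddTorus (Fin (d + 1))) :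
    descend G (-t) = conj (descend G t) := by
  set s : Fin (d + 1) → ℝ := fun i => rep (t i) with hs_def
  -- `rep` is a section of the quotient map (`↑(rep x) = x`; inlined — the statement is a landed lemma of another cell's tree,
  -- `Literature.AlgebraicTopology.SingularHomology.coe_circleRep`, whose import closure is kept out of the β sub-cell)
  have ht : t = fun i => ((s i : ℝ) : UnitAddCircle) := by
    funext i; exact ((AddCircle.equivIco (1 : ℝ) (-(1 / 2 : ℝ))).symm_apply_apply (t i)).symm
  have hs : s ∈ unitBox d := ⟨fun i => (rep_mem (t i)).1, fun i => (rep_mem (t i)).2.le⟩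
  have hns : (fun i => -s i) ∈ unitBox d := by
    refine ⟨fun i => ?_, fun i => ?_⟩
    · have := (rep_mem (t i)).2; simp only; linarith
    · have := (rep_mem (t i)).1; simp only; linarith
  have hneg : -t = fun i => (((-s i : ℝ)) : UnitAddCircle) := by
    funext i; rw [ht]; simp
  rw [hneg, descend_coe h hκ hns, ht, descend_coe h hκ hs]
  have e : (ofRealVec fun i => 2 * π * -s i) = ofRealVec (-(fun i => 2 * π * s i)) := by
    funext i; simp [ofRealVec]
  rw [e, hsym]

/-- **THE `t(−q) = conj t(q)` LEMMA AT THE NODES**: `descend G (gridPt P (−w)) = conj (descend G (gridPt P w))`. [folklore] -/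
theorem descend_gridPt_neg [NeZero P] {G : (Fin (d + 1) → ℂ) → ℂ} {κ M : ℝ} (h : StripRegular G κ M) (hκ : 0 ≤ κ)
    (hsym : ∀ p : Fin (d + 1) → ℝ, G (ofRealVec (-p)) = conj (G (ofRealVec p))) (w : Fin (d + 1) → Fin P) :
    descend G (gridPt P (-w)) = conj (descend G (gridPt P w)) := by
  rw [gridPt_neg, descend_neg h hκ hsym]

/-- hence the REAL PARTS agree at `±w` and the imaginary parts are opposite. [folklore] -/
theorem descend_gridPt_neg_re [NeZero P] {G : (Fin (d + 1) → ℂ) → ℂ} {κ M : ℝ} (h : StripRegular G κ M) (hκ : 0 ≤ κ)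
    (hsym : ∀ p : Fin (d + 1) → ℝ, G (ofRealVec (-p)) = conj (G (ofRealVec p))) (w : Fin (d + 1) → Fin P) :
    (descend G (gridPt P (-w))).re = (descend G (gridPt P w)).re := by
  rw [descend_gridPt_neg h hκ hsym, Complex.conj_re]

/-- A finite set of a commutative additive group that contains `0` and is closed under addition is closed under negation
(translation by `w` maps `S` injectively into `S`, hence onto; `0` has a preimage).  So `code16Set N`, `code16SetE N` are
negation-closed by `zero_mem_…`/`add_mem_…`. [folklore] -/
theorem neg_mem_of_add_closed {α : Type*} [AddCommGroup α] [DecidableEq α] {S : Finset α} (h0 : (0 : α) ∈ S)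
    (hadd : ∀ k ∈ S, ∀ w ∈ S, k + w ∈ S) : ∀ w ∈ S, -w ∈ S := by
  intro w hw
  have hsub : S.image (fun x => w + x) ⊆ S := by
    intro y hy
    obtain ⟨x, hx, rfl⟩ := Finset.mem_image.mp hy
    exact hadd w hw x hx
  have hcard : S.card ≤ (S.image (fun x => w + x)).card := by
    rw [Finset.card_image_of_injective S (add_right_injective w)]
  have heq : S.image (fun x => w + x) = S := Finset.eq_of_subset_of_card_le hsub hcard
  have h0' : (0 : α) ∈ S.image (fun x => w + x) := by rw [heq]; exact h0
  obtain ⟨x, hx, hx0⟩ := Finset.mem_image.mp h0'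
  have : x = -w := eq_neg_of_add_eq_zero_right hx0
  rw [← this]; exact hx

/-- in particular for the engine-convention code16 node set. [folklore] -/
theorem neg_mem_code16SetE {N : ℕ} [NeZero (4 * N)] : ∀ w ∈ code16SetE N, -w ∈ code16SetE N :=
  neg_mem_of_add_closed zero_mem_code16SetE (fun _ hk _ hw => add_mem_code16SetE hk hw)

/-! ## §2 The node-set sum over a negation-closed set: self-conjugate, real, paired -/

section Sum

variable [NeZero P] {G : (Fin (d + 1) → ℂ) → ℂ} {κ M : ℝ} {S : Finset (Fin (d + 1) → Fin P)}

/-- **THE NODE SUM IS SELF-CONJUGATE** when `S = −S` and `G(−p) = conj G(p)`. [folklore] -/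
theorem conj_sum_descend (hS : ∀ w ∈ S, -w ∈ S) (h : StripRegular G κ M) (hκ : 0 ≤ κ)
    (hsym : ∀ p : Fin (d + 1) → ℝ, G (ofRealVec (-p)) = conj (G (ofRealVec p))) :
    conj (∑ w ∈ S, descend G (gridPt P w)) = ∑ w ∈ S, descend G (gridPt P w) := by
  rw [map_sum]
  calc ∑ w ∈ S, conj (descend G (gridPt P w)) = ∑ w ∈ S, descend G (gridPt P (-w)) :=
        Finset.sum_congr rfl fun w _ => (descend_gridPt_neg h hκ hsym w).symm
    _ = ∑ w ∈ S, descend G (gridPt P w) :=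
        Finset.sum_nbij' (fun w => -w) (fun w => -w) hS hS (fun a _ => neg_neg a) (fun a _ => neg_neg a) (fun _ _ => rfl)

/-- hence its imaginary part vanishes … [folklore] -/
theorem sum_descend_im (hS : ∀ w ∈ S, -w ∈ S) (h : StripRegular G κ M) (hκ : 0 ≤ κ)
    (hsym : ∀ p : Fin (d + 1) → ℝ, G (ofRealVec (-p)) = conj (G (ofRealVec p))) :
    (∑ w ∈ S, descend G (gridPt P w)).im = 0 :=
  Complex.conj_eq_iff_im.mp (conj_sum_descend hS h hκ hsym)

/-- … and it EQUALS THE SUM OF THE REAL PARTS (what an engine summing `Re g` — fully or by pairs — computes). [folklore] -/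
theorem sum_descend_eq_sum_re (hS : ∀ w ∈ S, -w ∈ S) (h : StripRegular G κ M) (hκ : 0 ≤ κ)
    (hsym : ∀ p : Fin (d + 1) → ℝ, G (ofRealVec (-p)) = conj (G (ofRealVec p))) :
    ∑ w ∈ S, descend G (gridPt P w) = ((∑ w ∈ S, (descend G (gridPt P w)).re : ℝ) : ℂ) := by
  have hc := Complex.conj_eq_iff_re.mp (conj_sum_descend hS h hκ hsym)
  rw [← hc, Complex.re_sum, Complex.ofReal_sum]

/-- **THE PAIRING IDENTITY** (QHALF): for any representative system — `S₀ ⊆ S` the self-conjugate nodes, `R ⊆ S` one node of each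
pair, `S = S₀ ∪ R ∪ (−R)` with the three parts pairwise disjoint (decidable facts the certificate carries) —
`Σ_{w ∈ S} Re g(w) = Σ_{w ∈ S₀} Re g(w) + 2·Σ_{w ∈ R} Re g(w)`. [folklore] -/
theorem sum_re_pairing (h : StripRegular G κ M) (hκ : 0 ≤ κ)
    (hsym : ∀ p : Fin (d + 1) → ℝ, G (ofRealVec (-p)) = conj (G (ofRealVec p))) (S₀ R : Finset (Fin (d + 1) → Fin P))
    (hdec : S = S₀ ∪ R ∪ R.image (fun w => -w)) (hd₁ : Disjoint S₀ R) (hd₂ : Disjoint S₀ (R.image fun w => -w))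
    (hd₃ : Disjoint R (R.image fun w => -w)) :
    ∑ w ∈ S, (descend G (gridPt P w)).re =
      ∑ w ∈ S₀, (descend G (gridPt P w)).re + 2 * ∑ w ∈ R, (descend G (gridPt P w)).re := by
  have hinj : ∀ x ∈ R, ∀ y ∈ R, -x = -y → x = y := fun x _ y _ hxy => neg_injective hxy
  rw [hdec, Finset.sum_union (Finset.disjoint_union_left.mpr ⟨hd₂, hd₃⟩), Finset.sum_union hd₁, Finset.sum_image hinj]
  have hre : ∑ x ∈ R, (descend G (gridPt P (-x))).re = ∑ x ∈ R, (descend G (gridPt P x)).re :=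
    Finset.sum_congr rfl fun w _ => descend_gridPt_neg_re h hκ hsym w
  rw [hre]
  ring

/-- **THE BALL TRANSFER**: a certified REAL ball for the mean of the real parts IS the complex ball `hT` of
`CapRowsLattice.rowsOfSampling ∕ rowsOfCode16(E)` — `‖|S|⁻¹ Σ_S g − t‖ ≤ r`. [folklore] -/
theorem ball_of_real_ball (hS : ∀ w ∈ S, -w ∈ S) (h : StripRegular G κ M) (hκ : 0 ≤ κ)
    (hsym : ∀ p : Fin (d + 1) → ℝ, G (ofRealVec (-p)) = conj (G (ofRealVec p))) {t r : ℝ}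
    (hT : |(S.card : ℝ)⁻¹ * (∑ w ∈ S, (descend G (gridPt P w)).re) - t| ≤ r) :
    ‖(S.card : ℂ)⁻¹ * (∑ w ∈ S, descend G (gridPt P w)) - t‖ ≤ r := by
  rw [sum_descend_eq_sum_re hS h hκ hsym]
  have e : (S.card : ℂ)⁻¹ * (((∑ w ∈ S, (descend G (gridPt P w)).re : ℝ) : ℂ)) - (t : ℂ) =
      ((((S.card : ℝ)⁻¹ * (∑ w ∈ S, (descend G (gridPt P w)).re) - t : ℝ)) : ℂ) := by
    push_cast; ring
  rw [e, Complex.norm_real, Real.norm_eq_abs]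
  exact hT

end Sum

/-! ## §3 The code16 anchor from a real (paired) ball -/

section Anchor

variable {b : ℕ → ℝ}

/-- **THE ANCHOR ROW FROM A REAL BALL** (code16, engine convention): the binders of `CapRowsLattice.rowsOfCode16E` with the engine ball
replaced by a certified REAL ball for the mean of `Re G` over the nodes (as a full or PAIRED sum produces it, §2) plus the structural
symmetry `hsym` ⟹ `Rows b`, `k₀ = 0`.  R61-b (iv) on the kernel side: the paired sum instantiates `hT` through `ball_of_real_ball`,
whose `t(−q) = conj t(q)` ingredient is `descend_gridPt_neg`. [folklore] -/
def rowsOfCode16E_ofRealBall {G : (Fin 4 → ℂ) → ℂ} {κ M : ℝ} (hb : b 0 = (latticeKernel G 0).re) (h : StripRegularC G κ M)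
    (hκ : 0 < κ) (hsym : ∀ p : Fin 4 → ℝ, G (ofRealVec (-p)) = conj (G (ofRealVec p))) {N : ℕ} (hN : 1 ≤ N)
    [NeZero (4 * N)] {t r : ℝ}
    (hT : |((code16SetE N).card : ℝ)⁻¹ * (∑ w ∈ code16SetE N, (descend G (gridPt (4 * N) w)).re) - t| ≤ r)
    {A : ℝ} (hA : M * codeTheta (aliasRatioL1 κ N) ≤ A) (lo : ℚ) (hlo : ((lo : ℚ) : ℝ) ≤ t - r - A) : Rows b :=
  rowsOfCode16E hb h hκ hN
    (ball_of_real_ball neg_mem_code16SetE (h.toStripRegular hκ.le) hκ.le hsym hT) hA lo hlo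

/-- its constants: `k₀ = 0`, `m = m₀ = lo`. [folklore] -/
theorem rowsOfCode16E_ofRealBall_consts {G : (Fin 4 → ℂ) → ℂ} {κ M : ℝ} (hb : b 0 = (latticeKernel G 0).re)
    (h : StripRegularC G κ M) (hκ : 0 < κ) (hsym : ∀ p : Fin 4 → ℝ, G (ofRealVec (-p)) = conj (G (ofRealVec p)))
    {N : ℕ} (hN : 1 ≤ N) [NeZero (4 * N)] {t r : ℝ}
    (hT : |((code16SetE N).card : ℝ)⁻¹ * (∑ w ∈ code16SetE N, (descend G (gridPt (4 * N) w)).re) - t| ≤ r)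
    {A : ℝ} (hA : M * codeTheta (aliasRatioL1 κ N) ≤ A) (lo : ℚ) (hlo : ((lo : ℚ) : ℝ) ≤ t - r - A) :
    (rowsOfCode16E_ofRealBall hb h hκ hsym hN hT hA lo hlo).k₀ = 0 ∧
      (rowsOfCode16E_ofRealBall hb h hκ hsym hN hT hA lo hlo).m = lo ∧
      (rowsOfCode16E_ofRealBall hb h hκ hsym hN hT hA lo hlo).m₀ = lo := by
  refine ⟨rfl, rfl, ?_⟩
  simp [Rows.m₀, rowsOfCode16E_ofRealBall, rowsOfCode16E]

end Anchor

end

end Summit.QuantumFields.BalabanUV.Beta.CapRowsQhalf
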